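import Literature.Analysis.FluidPDE.AdaptedBackwardKernel
import Literature.Analysis.FluidPDE.EssCurry
import Mathlib.MeasureTheory.Function.L2Space

/-!
# Crux `AdaptedKernelExists` (stmt-NavierStokesRegularity-2956), line `nash-entropy-last-block`:
  slice calculus of space–time test functions for STUB `stub_weakCorrector`

Helper file (lands `--supports stmt-NavierStokesRegularity-2956`) for the registered stub
`stub_weakCorrector` (the very weak `L²` corrector by J.-L. Lions' projection lemma).  The very
weak form of the line is written with SLICE derivatives of a test function
`φ : ℝ × ℝ³ → ℝ` (`deriv (fun s => φ (s, x)) t`, `fderiv ℝ (fun y => φ (t, y)) x`,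
`Δ (fun y => φ (t, y)) x`); this file is the dictionary with the joint (frame) derivatives of
the tree's `Carleman` calculus (`FluidPDE/CarlemanCalculus`, `FluidPDE/EssCurry`) and its
consequences for smooth compactly supported `φ`:

* `weakCorrector_deriv_slice_eq`, `weakCorrector_fderiv_slice_eq`,
  `weakCorrector_laplacian_slice_eq`: slice derivatives are `Dφ(p)(1,0)`, `Dφ(p)(0,v)`,
  `Carleman.lap φ p`;
* joint continuity, vanishing off `tsupport φ` and compact support of the three slice fields
  (the drift coefficient `b` only needs to be jointly continuous);
* additivity and homogeneity of the slice fields, and the exponential shift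
  `ψ = e^{-t} φ` (`weakCorrector_shift_*`), which turns the operator
  `∂ₜ + b·∇ − νΔ + 1` into `e^{-t}(∂ₜ + b·∇ − νΔ)`;
* the gluing lemma `weakCorrector_continuous_mul_of_tsupport` (a product `g · f` is continuous
  when `g` is continuous on an open set containing `tsupport f`), its integrability corollary,
  and the time bounds `weakCorrector_time_bounds` of a compact support inside `{t < T}`.

Its registered sub-goal is `stub_weakCorrector_shift` (the shift identity in closed form).
-/

noncomputable section

open MeasureTheory Set Filter Topology Metric Function
open scoped ContDiff Laplacian InnerProductSpace

namespace Summit.NavierStokesRegularity.NavierStokesRegularity.Theorems.AdaptedKernelExists.NashEntropyLastBlock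

open Literature.Analysis.FluidPDE


section SliceCalculus

variable {φ χ : ℝ × (EuclideanSpace ℝ (Fin 3)) → ℝ}

/-- A space slice of a `C^n` function on `ℝ × ℝ³` is `C^n`. -/
theorem weakCorrector_contDiff_slice_x {n : WithTop ℕ∞} (hφ : ContDiff ℝ n φ) (t : ℝ) :
    ContDiff ℝ n fun y : (EuclideanSpace ℝ (Fin 3)) => φ (t, y) :=
  hφ.comp (contDiff_const.prodMk contDiff_id)

/-- A time line of a `C^n` function on `ℝ × ℝ³` is `C^n`. -/
theorem weakCorrector_contDiff_slice_t {n : WithTop ℕ∞} (hφ : ContDiff ℝ n φ) (x : (EuclideanSpace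
    ℝ (Fin 3))) :
    ContDiff ℝ n fun s : ℝ => φ (s, x) :=
  hφ.comp (contDiff_id.prodMk contDiff_const)

/-- `C^∞` functions are `C²`. -/
theorem weakCorrector_contDiff_two_of_infty (hφ : ContDiff ℝ ∞ φ) : ContDiff ℝ 2 φ :=
  contDiff_infty.1 hφ 2

/-- `C^∞` functions are `C¹`. -/
theorem weakCorrector_contDiff_one_of_infty (hφ : ContDiff ℝ ∞ φ) : ContDiff ℝ 1 φ :=
  contDiff_infty.1 hφ 1

/-- The slice time derivative is the joint derivative in the direction `(1, 0)`. -/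
theorem weakCorrector_deriv_slice_eq (hφ : ContDiff ℝ 1 φ) (p : ℝ × (EuclideanSpace ℝ (Fin 3))) :
    deriv (fun s => φ (s, p.2)) p.1 = fderiv ℝ φ p (1, 0) :=
  (Carleman.fderiv_apply_one_zero_eq_deriv_slice (hφ.differentiable one_ne_zero p)).symm

/-- The slice space derivative is the joint derivative in the direction `(0, v)`. -/
theorem weakCorrector_fderiv_slice_eq (hφ : ContDiff ℝ 1 φ) (p : ℝ × (EuclideanSpace ℝ (Fin 3))) (v
    : (EuclideanSpace ℝ (Fin 3))) :
    fderiv ℝ (fun y => φ (p.1, y)) p.2 v = fderiv ℝ φ p (0, v) :=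
  (Carleman.fderiv_apply_zero_eq_fderiv_slice (hφ.differentiable one_ne_zero p) v).symm

/-- The slice Laplacian is the frame Laplacian `Carleman.lap`. -/
theorem weakCorrector_laplacian_slice_eq (hφ : ContDiff ℝ 2 φ) (p : ℝ × (EuclideanSpace ℝ (Fin 3)))
    :
    (Δ (fun y => φ (p.1, y))) p.2 = Carleman.lap φ p := by
  have h := Carleman.lap_uncurry (u := fun t y => φ (t, y)) (t := p.1) (x := p.2) isOpen_univ
    (mem_univ _) (hφ.contDiffOn (s := univ))
  exact h.symm

/-! #### Joint continuity of the slice fields -/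

/-- The slice time derivative of a `C¹` function is jointly continuous. -/
theorem weakCorrector_continuous_deriv_slice (hφ : ContDiff ℝ 1 φ) :
    Continuous fun p : ℝ × (EuclideanSpace ℝ (Fin 3)) => deriv (fun s => φ (s, p.2)) p.1 := by
  have h : (fun p : ℝ × (EuclideanSpace ℝ (Fin 3)) => deriv (fun s => φ (s, p.2)) p.1) = fun p =>
      fderiv ℝ φ p (1, 0) :=
    funext fun p => weakCorrector_deriv_slice_eq hφ p
  rw [h]
  exact (hφ.continuous_fderiv one_ne_zero).clm_apply continuous_const

/-- The drift term `D(φ(t,·))(x)(b(t,x))` of a `C¹` function is jointly continuous when the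
drift is. -/
theorem weakCorrector_continuous_fderiv_slice (hφ : ContDiff ℝ 1 φ) {b : ℝ → (EuclideanSpace ℝ (Fin
    3)) → (EuclideanSpace ℝ (Fin 3))}
    (hb : Continuous (uncurry b)) :
    Continuous fun p : ℝ × (EuclideanSpace ℝ (Fin 3)) => fderiv ℝ (fun y => φ (p.1, y)) p.2 (b p.1
        p.2) := by
  have h : (fun p : ℝ × (EuclideanSpace ℝ (Fin 3)) => fderiv ℝ (fun y => φ (p.1, y)) p.2 (b p.1
      p.2)) =
      fun p => fderiv ℝ φ p (0, b p.1 p.2) :=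
    funext fun p => weakCorrector_fderiv_slice_eq hφ p _
  rw [h]
  exact (hφ.continuous_fderiv one_ne_zero).clm_apply (continuous_const.prodMk hb)

/-- The slice Laplacian of a smooth function is jointly continuous. -/
theorem weakCorrector_continuous_laplacian_slice (hφ : ContDiff ℝ ∞ φ) :
    Continuous fun p : ℝ × (EuclideanSpace ℝ (Fin 3)) => (Δ (fun y => φ (p.1, y))) p.2 := by
  have h : (fun p : ℝ × (EuclideanSpace ℝ (Fin 3)) => (Δ (fun y => φ (p.1, y))) p.2) = Carleman.lap
      φ :=
    funext fun p => weakCorrector_laplacian_slice_eq (weakCorrector_contDiff_two_of_infty hφ) p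
  rw [h]
  exact (Carleman.contDiff_lap hφ).continuous

/-! #### Support of the slice fields -/

/-- The slice time derivative vanishes off `tsupport φ`. -/
theorem weakCorrector_deriv_slice_eq_zero (hφ : ContDiff ℝ 1 φ) {p : ℝ × (EuclideanSpace ℝ (Fin 3))}
    (hp : p ∉ tsupport φ) : deriv (fun s => φ (s, p.2)) p.1 = 0 := by
  rw [weakCorrector_deriv_slice_eq hφ p, fderiv_of_notMem_tsupport (𝕜 := ℝ) hp]
  rfl

/-- The slice space derivative vanishes off `tsupport φ`. -/
theorem weakCorrector_fderiv_slice_eq_zero (hφ : ContDiff ℝ 1 φ) {p : ℝ × (EuclideanSpace ℝ (Fin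
    3))}
    (hp : p ∉ tsupport φ) (v : (EuclideanSpace ℝ (Fin 3))) : fderiv ℝ (fun y => φ (p.1, y)) p.2 v =
        0 := by
  rw [weakCorrector_fderiv_slice_eq hφ p, fderiv_of_notMem_tsupport (𝕜 := ℝ) hp]
  rfl

/-- The slice Laplacian vanishes off `tsupport φ`. -/
theorem weakCorrector_laplacian_slice_eq_zero (hφ : ContDiff ℝ 2 φ) {p : ℝ × (EuclideanSpace ℝ (Fin
    3))}
    (hp : p ∉ tsupport φ) : (Δ (fun y => φ (p.1, y))) p.2 = 0 := by
  rw [weakCorrector_laplacian_slice_eq hφ p]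
  exact image_eq_zero_of_notMem_tsupport fun h => hp (Carleman.tsupport_lap_subset φ h)

/-- The function itself vanishes off `tsupport φ`. -/
theorem weakCorrector_eq_zero_of_notMem_tsupport {p : ℝ × (EuclideanSpace ℝ (Fin 3))} (hp : p ∉
    tsupport φ) : φ p = 0 :=
  image_eq_zero_of_notMem_tsupport hp

/-- Slices of compactly supported functions have compact support. -/
theorem weakCorrector_hasCompactSupport_slice (hc : HasCompactSupport φ) (t : ℝ) :
    HasCompactSupport fun y : (EuclideanSpace ℝ (Fin 3)) => φ (t, y) :=
  HasCompactSupport.of_support_subset_isCompact (hc.image continuous_snd) fun y hy =>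
    ⟨(t, y), subset_tsupport φ hy, rfl⟩

/-- A function vanishing off `tsupport φ` has compact support when `φ` has. -/
theorem weakCorrector_hasCompactSupport_of_eq_zero {f : ℝ × (EuclideanSpace ℝ (Fin 3)) → ℝ} (hc :
    HasCompactSupport φ)
    (h : ∀ p, p ∉ tsupport φ → f p = 0) : HasCompactSupport f :=
  hc.mono' fun p hp => by_contra fun hp' => hp (h p hp')

/-- A function vanishing off `tsupport φ` has its topological support inside `tsupport φ`. -/
theorem weakCorrector_tsupport_subset_of_eq_zero {f : ℝ × (EuclideanSpace ℝ (Fin 3)) → ℝ}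
    (h : ∀ p, p ∉ tsupport φ → f p = 0) : tsupport f ⊆ tsupport φ :=
  closure_minimal (fun p hp => by_contra fun hp' => hp (h p hp')) (isClosed_tsupport φ)

/-- **Gluing.** If `g` is continuous on an open set `U` containing `tsupport f` and `f` is
continuous, then `g · f` is continuous (it vanishes near every point outside `U`). -/
theorem weakCorrector_continuous_mul_of_tsupport {g f : ℝ × (EuclideanSpace ℝ (Fin 3)) → ℝ} {U :
    Set (ℝ × (EuclideanSpace ℝ (Fin 3)))}
    (hU : IsOpen U) (hg : ContinuousOn g U) (hf : Continuous f) (hfU : tsupport f ⊆ U) :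
    Continuous fun p => g p * f p := by
  rw [continuous_iff_continuousAt]
  intro p
  by_cases hp : p ∈ U
  · exact (hg.continuousAt (hU.mem_nhds hp)).mul hf.continuousAt
  · have hp' : p ∉ tsupport f := fun h => hp (hfU h)
    have hev : (fun q => g q * f q) =ᶠ[𝓝 p] fun _ => 0 := by
      filter_upwards [notMem_tsupport_iff_eventuallyEq.1 hp'] with q hq
      simp [hq]
    exact continuousAt_const.congr_of_eventuallyEq hev

/-- **Integrability by gluing**: `g · f` is integrable on `ℝ × ℝ³` when `g` is continuous on an
open set `U`, `f` is continuous and vanishes off `tsupport φ ⊆ U` for a compactly supported `φ`. -/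
theorem weakCorrector_integrable_mul_of_tsupport {g f : ℝ × (EuclideanSpace ℝ (Fin 3)) → ℝ} {U :
    Set (ℝ × (EuclideanSpace ℝ (Fin 3)))}
    (hU : IsOpen U) (hg : ContinuousOn g U) (hf : Continuous f) (hc : HasCompactSupport φ)
    (hφU : tsupport φ ⊆ U) (hf0 : ∀ p, p ∉ tsupport φ → f p = 0) :
    Integrable (fun p => g p * f p) := by
  refine (weakCorrector_continuous_mul_of_tsupport hU hg hf
    ((weakCorrector_tsupport_subset_of_eq_zero hf0).trans hφU)).integrable_of_hasCompactSupport ?_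
  exact weakCorrector_hasCompactSupport_of_eq_zero hc fun p hp => by
    simp only [hf0 p hp, mul_zero]

/-- Continuous compactly supported functions on `ℝ × ℝ³` are in `L²` of every restriction of
Lebesgue measure. -/
theorem weakCorrector_memLp_restrict {f : ℝ × (EuclideanSpace ℝ (Fin 3)) → ℝ} (hf : Continuous f)
    (hc : HasCompactSupport f) (S : Set (ℝ × (EuclideanSpace ℝ (Fin 3)))) : MemLp f 2
        (volume.restrict S) :=
  (hf.memLp_of_hasCompactSupport hc).restrict S

/-! #### Linearity of the slice fields -/

/-- Additivity of the slice time derivative. -/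
theorem weakCorrector_deriv_slice_add (hφ : ContDiff ℝ 1 φ) (hχ : ContDiff ℝ 1 χ) (p : ℝ ×
    (EuclideanSpace ℝ (Fin 3))) :
    deriv (fun s => (φ + χ) (s, p.2)) p.1 =
      deriv (fun s => φ (s, p.2)) p.1 + deriv (fun s => χ (s, p.2)) p.1 := by
  simp only [Pi.add_apply]
  exact deriv_fun_add ((weakCorrector_contDiff_slice_t hφ p.2).differentiable one_ne_zero _)
    ((weakCorrector_contDiff_slice_t hχ p.2).differentiable one_ne_zero _)

/-- Homogeneity of the slice time derivative. -/
theorem weakCorrector_deriv_slice_smul (c : ℝ) (p : ℝ × (EuclideanSpace ℝ (Fin 3))) :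
    deriv (fun s => (c • φ) (s, p.2)) p.1 = c * deriv (fun s => φ (s, p.2)) p.1 := by
  simp only [Pi.smul_apply, smul_eq_mul]
  exact deriv_const_mul_field c

/-- Additivity of the slice space derivative. -/
theorem weakCorrector_fderiv_slice_add (hφ : ContDiff ℝ 1 φ) (hχ : ContDiff ℝ 1 χ) (p : ℝ ×
    (EuclideanSpace ℝ (Fin 3)))
    (v : (EuclideanSpace ℝ (Fin 3))) :
    fderiv ℝ (fun y => (φ + χ) (p.1, y)) p.2 v =
      fderiv ℝ (fun y => φ (p.1, y)) p.2 v + fderiv ℝ (fun y => χ (p.1, y)) p.2 v := by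
  simp only [Pi.add_apply]
  rw [fderiv_fun_add ((weakCorrector_contDiff_slice_x hφ p.1).differentiable one_ne_zero _)
    ((weakCorrector_contDiff_slice_x hχ p.1).differentiable one_ne_zero _)]
  rfl

/-- Homogeneity of the slice space derivative. -/
theorem weakCorrector_fderiv_slice_smul (hφ : ContDiff ℝ 1 φ) (c : ℝ) (p : ℝ × (EuclideanSpace ℝ
    (Fin 3))) (v : (EuclideanSpace ℝ (Fin 3))) :
    fderiv ℝ (fun y => (c • φ) (p.1, y)) p.2 v = c * fderiv ℝ (fun y => φ (p.1, y)) p.2 v := by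
  simp only [Pi.smul_apply, smul_eq_mul]
  rw [fderiv_const_mul ((weakCorrector_contDiff_slice_x hφ p.1).differentiable one_ne_zero _)]
  rfl

/-- Additivity of the slice Laplacian. -/
theorem weakCorrector_laplacian_slice_add (hφ : ContDiff ℝ 2 φ) (hχ : ContDiff ℝ 2 χ)
    (p : ℝ × (EuclideanSpace ℝ (Fin 3))) :
    (Δ (fun y => (φ + χ) (p.1, y))) p.2 =
      (Δ (fun y => φ (p.1, y))) p.2 + (Δ (fun y => χ (p.1, y))) p.2 := by
  have h : (fun y => (φ + χ) (p.1, y)) = (fun y => φ (p.1, y)) + fun y => χ (p.1, y) := rfl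
  rw [h]
  exact ((weakCorrector_contDiff_slice_x hφ p.1).contDiffAt).laplacian_add
    ((weakCorrector_contDiff_slice_x hχ p.1).contDiffAt)

/-- Homogeneity of the slice Laplacian. -/
theorem weakCorrector_laplacian_slice_smul (hφ : ContDiff ℝ 2 φ) (c : ℝ) (p : ℝ × (EuclideanSpace ℝ
    (Fin 3))) :
    (Δ (fun y => (c • φ) (p.1, y))) p.2 = c * (Δ (fun y => φ (p.1, y))) p.2 := by
  have h : (fun y => (c • φ) (p.1, y)) = c • fun y => φ (p.1, y) := rfl
  rw [h, InnerProductSpace.laplacian_smul c ((weakCorrector_contDiff_slice_x hφ p.1).contDiffAt)]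
  rfl

/-! #### The exponential shift `ψ = e^{-t} φ` -/

/-- `e^{-t} φ` is smooth. -/
theorem weakCorrector_shift_contDiff (hφ : ContDiff ℝ ∞ φ) :
    ContDiff ℝ ∞ fun p : ℝ × (EuclideanSpace ℝ (Fin 3)) => Real.exp (-p.1) * φ p :=
  (contDiff_fst.neg.exp).mul hφ

/-- `e^{-t} φ` has compact support when `φ` has. -/
theorem weakCorrector_shift_hasCompactSupport (hc : HasCompactSupport φ) :
    HasCompactSupport fun p : ℝ × (EuclideanSpace ℝ (Fin 3)) => Real.exp (-p.1) * φ p :=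
  hc.mul_left

/-- Time derivative of the shift: `∂ₜ(e^{-t}φ) = -e^{-t}φ + e^{-t}∂ₜφ`. -/
theorem weakCorrector_shift_deriv (hφ : ContDiff ℝ 1 φ) (p : ℝ × (EuclideanSpace ℝ (Fin 3))) :
    deriv (fun s => Real.exp (-s) * φ (s, p.2)) p.1 =
      -(Real.exp (-p.1) * φ p) + Real.exp (-p.1) * deriv (fun s => φ (s, p.2)) p.1 := by
  have h1 : HasDerivAt (fun s => Real.exp (-s)) (Real.exp (-p.1) * -1) p.1 :=
    (hasDerivAt_neg p.1).exp
  have h2 : HasDerivAt (fun s => φ (s, p.2)) (deriv (fun s => φ (s, p.2)) p.1) p.1 :=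
    ((weakCorrector_contDiff_slice_t hφ p.2).differentiable one_ne_zero _).hasDerivAt
  rw [(h1.fun_mul h2).deriv]
  ring

/-- Space derivative of the shift: `∇(e^{-t}φ) = e^{-t}∇φ`. -/
theorem weakCorrector_shift_fderiv (hφ : ContDiff ℝ 1 φ) (p : ℝ × (EuclideanSpace ℝ (Fin 3))) (v :
    (EuclideanSpace ℝ (Fin 3))) :
    fderiv ℝ (fun y => Real.exp (-p.1) * φ (p.1, y)) p.2 v =
      Real.exp (-p.1) * fderiv ℝ (fun y => φ (p.1, y)) p.2 v := by
  rw [fderiv_const_mul ((weakCorrector_contDiff_slice_x hφ p.1).differentiable one_ne_zero _)]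
  rfl

/-- Laplacian of the shift: `Δ(e^{-t}φ) = e^{-t}Δφ`. -/
theorem weakCorrector_shift_laplacian (hφ : ContDiff ℝ 2 φ) (p : ℝ × (EuclideanSpace ℝ (Fin 3))) :
    (Δ (fun y => Real.exp (-p.1) * φ (p.1, y))) p.2 =
      Real.exp (-p.1) * (Δ (fun y => φ (p.1, y))) p.2 := by
  have h : (fun y => Real.exp (-p.1) * φ (p.1, y)) = Real.exp (-p.1) • fun y => φ (p.1, y) := by
    funext y; simp [smul_eq_mul]
  rw [h, InnerProductSpace.laplacian_smul (Real.exp (-p.1))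
    ((weakCorrector_contDiff_slice_x hφ p.1).contDiffAt)]
  rfl

/-- **The shift identity**: for `ψ = e^{-t}φ`,
`∂ₜψ + b·∇ψ − νΔψ + ψ = e^{-t}(∂ₜφ + b·∇φ − νΔφ)` pointwise. -/
theorem weakCorrector_shift_op (hφ : ContDiff ℝ ∞ φ) (ν : ℝ) (b : ℝ → (EuclideanSpace ℝ (Fin 3)) →
    (EuclideanSpace ℝ (Fin 3))) (p : ℝ × (EuclideanSpace ℝ (Fin 3))) :
    deriv (fun s => Real.exp (-s) * φ (s, p.2)) p.1 +
        fderiv ℝ (fun y => Real.exp (-p.1) * φ (p.1, y)) p.2 (b p.1 p.2) -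
        ν * (Δ (fun y => Real.exp (-p.1) * φ (p.1, y))) p.2 + Real.exp (-p.1) * φ p =
      Real.exp (-p.1) * (deriv (fun s => φ (s, p.2)) p.1 +
        fderiv ℝ (fun y => φ (p.1, y)) p.2 (b p.1 p.2) - ν * (Δ (fun y => φ (p.1, y))) p.2) := by
  rw [weakCorrector_shift_deriv (weakCorrector_contDiff_one_of_infty hφ),
    weakCorrector_shift_fderiv (weakCorrector_contDiff_one_of_infty hφ),
    weakCorrector_shift_laplacian (weakCorrector_contDiff_two_of_infty hφ)]
  ring

/-- Time bounds of a compact support inside `{t < T}`: there are `a < c < T` with the time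
projection of `tsupport φ` inside `(a, c)`. -/
theorem weakCorrector_time_bounds {T : ℝ} (hφc : HasCompactSupport φ)
    (hφT : tsupport φ ⊆ Iio T ×ˢ univ) :
    ∃ a c : ℝ, a < c ∧ c < T ∧ ∀ p ∈ tsupport φ, p.1 ∈ Ioo a c := by
  set K : Set ℝ := Prod.fst '' tsupport φ with hK
  have hKc : IsCompact K := hφc.image continuous_fst
  rcases K.eq_empty_or_nonempty with he | hne
  · refine ⟨T - 2, T - 1, by linarith, by linarith, fun p hp => ?_⟩
    have : p.1 ∈ K := ⟨p, hp, rfl⟩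
    rw [he] at this
    exact this.elim
  · obtain ⟨m, hm⟩ := hKc.bddBelow
    have hmax : sSup K ∈ K := hKc.sSup_mem hne
    obtain ⟨p₀, hp₀, hp₀eq⟩ := hmax
    have hlt : sSup K < T := by rw [← hp₀eq]; exact (hφT hp₀).1
    refine ⟨m - 1, (sSup K + T) / 2, ?_, by linarith, fun p hp => ⟨?_, ?_⟩⟩
    · have : m ≤ sSup K := hm ⟨p₀, hp₀, hp₀eq⟩
      linarith
    · have : m ≤ p.1 := hm ⟨p, hp, rfl⟩
      linarith
    · have : p.1 ≤ sSup K := le_csSup hKc.bddAbove ⟨p, hp, rfl⟩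
      linarith

end SliceCalculus

/-- **Registered sub-goal `stub_weakCorrector_shift`** (closed form of `weakCorrector_shift_op`):
the exponential shift `ψ = e^{-t}φ` conjugates `∂ₜ + b·∇ − νΔ + 1` to `e^{-t}(∂ₜ + b·∇ − νΔ)`. -/
theorem stub_weakCorrector_shift :
    ∀ (ν : ℝ) (b : ℝ → EuclideanSpace ℝ (Fin 3) → EuclideanSpace ℝ (Fin 3)) (φ : ℝ × EuclideanSpace ℝ (Fin 3) → ℝ), ContDiff ℝ ∞ φ → ∀ p : ℝ × EuclideanSpace ℝ (Fin 3), deriv (fun s => Real.exp (-s) * φ (s, p.2)) p.1 + fderiv ℝ (fun y => Real.exp (-p.1) * φ (p.1, y)) p.2 (b p.1 p.2) - ν * (Δ (fun y => Real.exp (-p.1) * φ (p.1, y))) p.2 + Real.exp (-p.1) * φ p = Real.exp (-p.1) * (deriv (fun s => φ (s, p.2)) p.1 + fderiv ℝ (fun y => φ (p.1, y)) p.2 (b p.1 p.2) - ν * (Δ (fun y => φ (p.1, y))) p.2) :=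
  fun ν b _ hφ p => weakCorrector_shift_op hφ ν b p

end Summit.NavierStokesRegularity.NavierStokesRegularity.Theorems.AdaptedKernelExists.NashEntropyLastBlock

end
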